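import Summits.SmoothPoincare4.Statement
import Literature.Topology.FourManifolds.HomotopyBallSlice
import Summits.SmoothPoincare4.SmoothPoincare4.Theses.ZeroSurgeryExotic
import Literature.Topology.FourManifolds.HomotopyBallSliceProofs
import Literature.Topology.FourManifolds.ZeroSurgeryHomotopyBallSliceProofs
import Literature.Topology.FourManifolds.ZeroSurgeryHomotopyBallSliceHolds

/-!
# SmoothPoincare4 / ZeroSurgeryExotic — the FGMW assembly

Problem `SmoothPoincare4`, topic `ZeroSurgeryExotic` (route ZeroSurgeryExotic, negative side).
Assembly v2 (a), stmt-SmoothPoincare4-0521: granted the FGMW lemma (in-tree named fact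
`Literature.Topology.FourManifolds.Knot.exists_exotic_of_isHomotopyBallSlice_not_isSmoothlySlice`: a knot slice in a homotopy
4-ball but not in `B⁴` yields a homotopy 4-sphere not diffeomorphic to `S⁴`), the waypoint
stmt-SmoothPoincare4-0520 (`∃ K, K.IsHomotopyBallSlice ∧ ¬ K.IsSmoothlySlice`) refutes
`SmoothPoincare4`. Pure logic: the exotic `Σ` produced by the fact is Hausdorff and second
countable, so SPC4 supplies a diffeomorphism `Σ ≃ₘ S⁴`, contradicting `IsEmpty`.
[Freedman–Gompf–Morrison–Walker 2010, §1; Manolescu–Piccirillo 2023, §1]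
-/

open scoped Manifold ContDiff
open ContinuousMap

namespace Summit.SmoothPoincare4.ZeroSurgeryExotic

/-- Settles stmt-SmoothPoincare4-0521 (assembly v2 (a)): the FGMW lemma and a knot that is slice
in a homotopy 4-ball but not in `B⁴` together contradict SPC4. [folklore] -/
theorem not_smoothPoincare4_of_isHomotopyBallSlice_not_isSmoothlySlice :
    Literature.Topology.FourManifolds.Knot.exists_exotic_of_isHomotopyBallSlice_not_isSmoothlySlice →
      (∃ K : Literature.Topology.FourManifolds.Knot, K.IsHomotopyBallSlice ∧ ¬ K.IsSmoothlySlice) → ¬ SmoothPoincare4 := by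
  intro hF hW hS
  obtain ⟨M, i₁, i₂, i₃, i₄, i₅, i₆, ⟨e⟩, hE⟩ := hF hW
  obtain ⟨d⟩ := hS M i₄ i₅ e
  exact hE.false d

end Summit.SmoothPoincare4.ZeroSurgeryExotic

/-!
## Appended 2026-08-16 — THE assembly of the route (item stmt-SmoothPoincare4-0365, decl `Assembly`)

`Summit.SmoothPoincare4.SmoothPoincare4.Theses.ZeroSurgeryExotic.Assembly` —
`(∃ K K' Y, Y is 0-surgery on K and on K' ∧ K smoothly slice ∧ K' not) → ¬ SmoothPoincare4` — is now a
THEOREM, unconditionally: both lemmas the printed argument uses are discharged in the tree,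

* Manolescu–Piccirillo's Lemma 3.3 for `W = S⁴` (`Knot.ManolescuPiccirillo2023_lemma33_sphere_holds`,
  `ZeroSurgeryHomotopyBallSliceHolds.lean`; hypotheses converted from `IsIntegralSurgery (𝓡 3) Y K 0` by
  `FramedLink.isSurgery_single_iff`): `K'` is slice in a homotopy 4-ball;
* the FGMW lemma (`Knot.exists_exotic_of_isHomotopyBallSlice_not_isSmoothlySlice_holds`,
  `HomotopyBallSliceProofs.lean`, via Palais' disc theorem): a knot slice in a homotopy ball but not in `B⁴`
  yields a closed smooth 4-manifold homotopy equivalent but not diffeomorphic to `S⁴`;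

composed with the glue `not_smoothPoincare4_of_isHomotopyBallSlice_not_isSmoothlySlice` above. With this the
route's deciding theorem `closes (hX : ZseThesis) (hA : Assembly)` depends on the thesis `ZseThesis` alone.
-/

namespace Summit.SmoothPoincare4.SmoothPoincare4.Theorems

open Literature.Topology.FourManifolds
open Summit.SmoothPoincare4.SmoothPoincare4.Theses.ZeroSurgeryExotic

/-- **Settles stmt-SmoothPoincare4-0365 (the route's assembly `Assembly`)**: a `0`-surgery pair `(K, K')`
with `K` smoothly slice and `K'` not smoothly slice refutes `SmoothPoincare4`. Proof: `K'` is slice in a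
homotopy 4-ball (Manolescu–Piccirillo Lemma 3.3 for `W = S⁴`, proved in the tree), hence, not being slice,
yields an exotic 4-sphere (FGMW lemma, proved in the tree), which SPC4 forbids.
[cite: ManolescuPiccirillo2023, §1 p. 1 and Lemma 3.3] -/
theorem assembly_proof : Assembly := by
  rintro ⟨K, K', Y, _, _, hK, hK', hsl, hns⟩
  exact Summit.SmoothPoincare4.ZeroSurgeryExotic.not_smoothPoincare4_of_isHomotopyBallSlice_not_isSmoothlySlice
    Knot.exists_exotic_of_isHomotopyBallSlice_not_isSmoothlySlice_holds
    ⟨K', Knot.ManolescuPiccirillo2023_lemma33_sphere_holds K K' Y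
      ((FramedLink.isSurgery_single_iff K 0).2 hK) ((FramedLink.isSurgery_single_iff K' 0).2 hK') hsl, hns⟩

end Summit.SmoothPoincare4.SmoothPoincare4.Theorems
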